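import Literature.NumberTheory.EllipticCurves.EisensteinValuesAtRhoSix
import Literature.NumberTheory.EllipticCurves.WeierstrassTransformation
import Literature.NumberTheory.EllipticCurves.LatticeJInvariant
import Literature.NumberTheory.EllipticCurves.RealLatticePeriod
import HarnessLib

/-!
# Complex multiplication by `1 − ρ` on the Eisenstein lattice `ℤρ + ℤ`: `℘(ρz) = ρ℘(z)`, `℘((2 + ρ)/3) = 0`, and
# `℘((1 − ρ)z) = −ρ²(℘(z)³ − g₃)/(3℘(z)²)` — in normalised coordinates `X((1 − ρ)z) = −ρ²(X³ − 4)/(3X²)`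

Topic `Literature/NumberTheory/EllipticCurves` (complex-lattice cluster), namespace `Literature.NumberTheory.EllipticCurves.EisensteinLattice`
(continuing `EisensteinValuesAtRhoSix`, `LatticeJInvariant`). The `ℤ[ρ]`-twin of `GaussianLatticeCMFive` (`℘((2 − i)z)` on `ℤi + ℤ`):
the degree-`3` endomorphism `[1 − ρ]` of `ℂ/(ℤρ + ℤ)` (`(1 − ρ)(1 − ρ²) = 3`) made explicit by the transformation of order three
(Lawden §9.8, tree `PeriodPair.weierstrassP_of_indexThree`) for the superlattice `(1 − ρ)⁻¹Λ = Λ ∪ (w + Λ) ∪ (−w + Λ)`, `w = (2 + ρ)/3`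
(`(1 − ρ)w = 1`), together with the symmetric addition formula `℘(z + w) + ℘(z − w)` (tree `weierstrassP_add_add_weierstrassP_sub`) and
the two special facts of the hexagonal lattice: `g₂ = 0` (`PeriodPair.g₂_ofUpperHalfPlane_ρ`) and **`℘(w) = 0`** (`ρw ≡ w (mod Λ)` and
`℘(ρz) = ρ℘(z)` force `(ρ − 1)℘(w) = 0`). Everything is proved; no definition, no named fact.

* `mulLeft_rho_lattice_eq`, `weierstrassP_rho_mul` — `ρΛ = Λ`, **`℘(ρz; Λ) = ρ·℘(z; Λ)`** (`℘_{ρΛ}(ρz) = ρ⁻²℘_Λ(z)`, `ρ⁻² = ρ`);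
* `one_sub_rho_mul_mem_lattice_iff` — the kernel of `[1 − ρ]`: `(1 − ρ)x ∈ Λ ↔ x ≡ 0, w, −w (mod Λ)`;
* `weierstrassP_two_add_rho_third` — **`℘((2 + ρ)/3) = 0`** (the zeros of the equianharmonic `℘` are the `3`-division points fixed by `ρ`);
* `weierstrassP_one_sub_rho_mul` — **`℘((1 − ρ)z) = −ρ²(℘(z)³ − g₃)/(3℘(z)²)`** for `(1 − ρ)z ∉ Λ` (then `℘(z) ≠ 0`);
* `normalizedX_one_sub_rho_mul` — with `X = ℘/ϖ₁²` (`g₃ = 4ϖ₁⁶`, `ϖ₁ = 2^{2/3}Γ(1/3)³/(4π)`, the coordinate of `y² = x³ − 1`):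
  **`X((1 − ρ)z) = −ρ²(X(z)³ − 4)/(3X(z)²)`**, and in `π = X⁻¹`: `π((1 − ρ)z) = −3ρ·π(z)/(1 − 4π(z)³)` (`inv_normalizedX_one_sub_rho_mul`,
  when `X((1 − ρ)z) ≠ 0`) — the algebraic `[√−3]`-type isogeny `x ↦ (x³ + 4B²)/(−3x²)` of `MordellCurveSqrtThreeEndomorphism` on `y² = x³ − 1`
  (`B² = −1`), up to the unit `ρ²`.

These are the LABELLING formulas of the `j = 0` / `p = 5` resolvent certificate of the BSD programme's crux `ManinDatumSupercuspidalCMInert`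
(stub `stub_S5`): with `π_c = X(c/5)⁻¹`, `π_{(1−ρ)c} = −3ρπ_c/(1 − 4π_c³)` and `π_{ζc} = ζ²π_c` (`ζ ∈ μ₆`) generate all `24` five-division values
from `π_1` (`(ℤ[ρ]/5)ˣ = ⟨1 − ρ⟩·μ₆`... indeed `1 − ρ` has order `24`).

## References
* D. F. Lawden, *Elliptic Functions and Applications*, Springer 1989, §9.8 (transformations of order `n`, (9.8.14)). [Lawden1989]
* D. A. Cox, *Primes of the form x² + ny²*, 2nd ed., §10.C and Exercise 10.17 (`ρL = L`, `℘(αz)` rational in `℘(z)`). [Cox2013]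

## Mathlib / tree search
Tree: `PeriodPair.weierstrassP_of_indexThree`, `weierstrassP_add_add_weierstrassP_sub`, `notMem/sub_notMem/add_notMem_of_notMem_of_indexThree`,
`mem_mulLeft_inv_lattice` (`WeierstrassTransformation`); `ρ_cube`, `ρ_ne_one`, `ρ_ne_zero`, `ρ_mul_mem_lattice_ofUpperHalfPlane_ρ_iff`,
`mulLeft_lattice_eq_of_mul_mem_lattice_iff`, `g₂_ofUpperHalfPlane_ρ` (`LatticeJInvariant`); `EisensteinLattice.mem_lattice_iff`, `g₃_eq_Gamma`
(`EisensteinValuesAtRhoSix`); `weierstrassP_eq_of_lattice_eq`, `weierstrassP_mulLeft` (`RealLatticePeriod`).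
Mathlib: `UpperHalfPlane.ρ`, `UpperHalfPlane.ρ_sq`, `PeriodPair.weierstrassP_add_coe`, `PeriodPair.weierstrassP_eq_weierstrassP_iff`.
-/

noncomputable section

open Complex PeriodPair Real

namespace Literature.NumberTheory.EllipticCurves

namespace EisensteinLattice

/-! ### The equianharmonic constant `ϖ₁ = 2^{2/3}Γ(1/3)³/(4π)`: `g₃(ℤρ + ℤ) = 4ϖ₁⁶` -/

/-- `0 < ϖ₁ = 2^{2/3}Γ(1/3)³/(4π)`. [cite: Waldschmidt2008EllipticSurvey, §2.3 formula (6)] -/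
theorem varpi₁_pos : 0 < (2 : ℝ) ^ (2 / 3 : ℝ) * Real.Gamma (1 / 3) ^ 3 / (4 * Real.pi) := by
  have h1 : 0 < (2 : ℝ) ^ (2 / 3 : ℝ) := Real.rpow_pos_of_pos two_pos _
  have h2 : 0 < Real.Gamma (1 / 3) := Real.Gamma_pos_of_pos (by norm_num)
  positivity

/-- **`g₃(ℤρ + ℤ) = 4ϖ₁⁶`** (`(2^{2/3})⁶ = 16` and `g₃_eq_Gamma`: `g₃ = Γ(1/3)¹⁸/(64π⁶)`), i.e. `X = ℘/ϖ₁²`, `Y = ℘′/(2ϖ₁³)` put `ℂ/(ℤρ + ℤ)` on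
`y² = x³ − 1`. (Also recorded, with a Summits-side name, in the BSD programme's `…FiveDivisionEisensteinJZero`.)
[cite: Waldschmidt2008EllipticSurvey, §2.3 formula (6)] -/
theorem g₃_eq_four_mul_varpi₁_pow_six :
    (ofUpperHalfPlane UpperHalfPlane.ρ).g₃ = 4 * (((2 : ℝ) ^ (2 / 3 : ℝ) * Real.Gamma (1 / 3) ^ 3 / (4 * Real.pi) : ℝ) : ℂ) ^ 6 := by
  rw [EisensteinLattice.g₃_eq_Gamma]
  have h16 : ((2 : ℝ) ^ (2 / 3 : ℝ)) ^ 6 = 16 := by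
    rw [← Real.rpow_natCast, ← Real.rpow_mul (by norm_num : (0 : ℝ) ≤ 2)]
    rw [show (2 / 3 : ℝ) * ((6 : ℕ) : ℝ) = ((4 : ℕ) : ℝ) by norm_num, Real.rpow_natCast]
    norm_num
  have hπ : (Real.pi : ℂ) ≠ 0 := Complex.ofReal_ne_zero.mpr Real.pi_ne_zero
  have e : (((2 : ℝ) ^ (2 / 3 : ℝ) * Real.Gamma (1 / 3) ^ 3 / (4 * Real.pi) : ℝ) : ℂ) ^ 6 =
      ((((2 : ℝ) ^ (2 / 3 : ℝ)) ^ 6 : ℝ) : ℂ) * (Real.Gamma (1 / 3) : ℂ) ^ 18 / ((4 : ℂ) ^ 6 * (Real.pi : ℂ) ^ 6) := by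
    push_cast
    ring
  rw [e, h16]
  push_cast
  field_simp
  ring

/-! ### `ρΛ = Λ` and `℘(ρz) = ρ℘(z)` -/

/-- `ρ(ℤρ + ℤ) = ℤρ + ℤ` as lattices. [cite: Cox2013, Exercise 10.17] -/
theorem mulLeft_rho_lattice_eq :
    ((ofUpperHalfPlane UpperHalfPlane.ρ).mulLeft (UpperHalfPlane.ρ : ℂ) ρ_ne_zero).lattice = (ofUpperHalfPlane UpperHalfPlane.ρ).lattice :=
  mulLeft_lattice_eq_of_mul_mem_lattice_iff ρ_ne_zero ρ_mul_mem_lattice_ofUpperHalfPlane_ρ_iff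

/-- **`℘(ρz) = ρ·℘(z)`** for the Eisenstein lattice (`℘_{ρΛ}(ρz) = ρ⁻²℘_Λ(z)`, `ρΛ = Λ`, `ρ⁻² = ρ`). [cite: Cox2013, §10.C] -/
theorem weierstrassP_rho_mul (z : ℂ) :
    ℘[ofUpperHalfPlane UpperHalfPlane.ρ] ((UpperHalfPlane.ρ : ℂ) * z) = (UpperHalfPlane.ρ : ℂ) * ℘[ofUpperHalfPlane UpperHalfPlane.ρ] z := by
  have h := PeriodPair.weierstrassP_mulLeft (UpperHalfPlane.ρ : ℂ) ρ_ne_zero (ofUpperHalfPlane UpperHalfPlane.ρ) z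
  rw [weierstrassP_eq_of_lattice_eq mulLeft_rho_lattice_eq] at h
  have h3 : (UpperHalfPlane.ρ : ℂ) ^ 3 = 1 := ρ_cube
  have hρρ : (UpperHalfPlane.ρ : ℂ) * (UpperHalfPlane.ρ : ℂ) ^ 2 = 1 := by rw [← pow_succ']; exact h3
  rw [h, inv_eq_of_mul_eq_one_left hρρ]

/-- `Λ` is a `ℤ[ρ]`-module: `(1 − ρ)l ∈ Λ` for `l ∈ Λ`. [cite: Cox2013, Exercise 10.17] -/
theorem one_sub_rho_mul_mem {l : ℂ} (hl : l ∈ (ofUpperHalfPlane UpperHalfPlane.ρ).lattice) :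
    (1 - (UpperHalfPlane.ρ : ℂ)) * l ∈ (ofUpperHalfPlane UpperHalfPlane.ρ).lattice := by
  rw [sub_mul, one_mul]
  exact sub_mem hl ((ρ_mul_mem_lattice_ofUpperHalfPlane_ρ_iff l).mpr hl)

/-! ### The kernel of `[1 − ρ]`: the points `±(2 + ρ)/3` -/

/-- `(1 − ρ)·(2 + ρ)/3 = 1`. [folklore] -/
private theorem one_sub_rho_mul_two_add_rho_third : (1 - (UpperHalfPlane.ρ : ℂ)) * ((2 + (UpperHalfPlane.ρ : ℂ)) / 3) = 1 := by
  have h : (1 - (UpperHalfPlane.ρ : ℂ)) * (2 + UpperHalfPlane.ρ) = 3 := by linear_combination (-1 : ℂ) * UpperHalfPlane.ρ_sq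
  rw [← mul_div_assoc, h, div_self (by norm_num : (3 : ℂ) ≠ 0)]

/-- A point `(uρ + v)/3` (`u, v ∈ ℤ`) lies in `ℤρ + ℤ` iff `3 ∣ u` and `3 ∣ v`. [folklore] -/
private theorem intCast_mul_rho_add_intCast_div_three_mem_iff (u v : ℤ) :
    (((u : ℂ) * UpperHalfPlane.ρ + v) / 3) ∈ (ofUpperHalfPlane UpperHalfPlane.ρ).lattice ↔ (3 : ℤ) ∣ u ∧ (3 : ℤ) ∣ v := by
  rw [EisensteinLattice.mem_lattice_iff]
  have hρ : ((UpperHalfPlane.ρ : UpperHalfPlane) : ℂ) = ⟨-1 / 2, Real.sqrt 3 / 2⟩ := rfl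
  constructor
  · rintro ⟨m, n, h⟩
    have h' : ((3 * m : ℤ) : ℂ) * UpperHalfPlane.ρ + ((3 * n : ℤ) : ℂ) = (u : ℂ) * UpperHalfPlane.ρ + (v : ℂ) := by
      push_cast; linear_combination (3 : ℂ) * h
    have him := congrArg Complex.im h'
    have hre := congrArg Complex.re h'
    simp only [hρ, Complex.add_im, Complex.mul_im, Complex.intCast_re, Complex.intCast_im, zero_mul, add_zero,
      Complex.add_re, Complex.mul_re, sub_zero] at him hre
    have hs : Real.sqrt 3 ≠ 0 := by positivity
    have hu : ((3 * m : ℤ) : ℝ) = u := by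
      have : (((3 * m : ℤ) : ℝ) - u) * (Real.sqrt 3 / 2) = 0 := by linarith
      rcases mul_eq_zero.mp this with h0 | h0
      · linarith
      · exfalso; apply hs; linarith
    have hv : ((3 * n : ℤ) : ℝ) = v := by
      have hu' : ((3 * m : ℤ) : ℝ) * (-1 / 2) = (u : ℝ) * (-1 / 2) := by rw [hu]
      linarith
    exact ⟨⟨m, by exact_mod_cast hu.symm⟩, ⟨n, by exact_mod_cast hv.symm⟩⟩
  · rintro ⟨⟨a, rfl⟩, ⟨b, rfl⟩⟩
    exact ⟨a, b, by push_cast; ring⟩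

/-- `k(2 + ρ)/3 ∉ Λ` for `k = 1, 2`. [folklore] -/
private theorem natCast_mul_two_add_rho_third_notMem {k : ℕ} (hk1 : 1 ≤ k) (hk2 : k ≤ 2) :
    (k : ℂ) * ((2 + (UpperHalfPlane.ρ : ℂ)) / 3) ∉ (ofUpperHalfPlane UpperHalfPlane.ρ).lattice := by
  rw [show (k : ℂ) * ((2 + (UpperHalfPlane.ρ : ℂ)) / 3) = ((((k : ℤ) : ℂ)) * UpperHalfPlane.ρ + ((2 * k : ℤ) : ℂ)) / 3 by push_cast; ring,
    intCast_mul_rho_add_intCast_div_three_mem_iff]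
  rintro ⟨h, -⟩
  omega

/-- **`w = (2 + ρ)/3 ∉ Λ`**: the kernel point of `[1 − ρ]` is non-zero modulo `Λ` (the transformation of order three has a
non-trivial kernel). [cite: Lawden1989, §9.8 eq. (9.8.14)] -/
theorem two_add_rho_third_notMem : ((2 + (UpperHalfPlane.ρ : ℂ)) / 3) ∉ (ofUpperHalfPlane UpperHalfPlane.ρ).lattice := by
  simpa using natCast_mul_two_add_rho_third_notMem (k := 1) le_rfl (by norm_num)

/-- **`2w ∉ Λ`** for `w = (2 + ρ)/3` (the second hypothesis of the order-three transformation). [cite: Lawden1989, §9.8 eq. (9.8.14)] -/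
theorem two_mul_two_add_rho_third_notMem : 2 * ((2 + (UpperHalfPlane.ρ : ℂ)) / 3) ∉ (ofUpperHalfPlane UpperHalfPlane.ρ).lattice := by
  exact_mod_cast natCast_mul_two_add_rho_third_notMem (k := 2) (by norm_num) le_rfl

/-- **The kernel of `[1 − ρ]`**: `(1 − ρ)x ∈ Λ ↔ x ≡ 0, w, −w (mod Λ)`, `w = (2 + ρ)/3` — the three-coset hypothesis of
`PeriodPair.weierstrassP_of_indexThree` for `(1 − ρ)⁻¹Λ` (`(1 − ρ)⁻¹Λ/Λ ≅ ℤ[ρ]/(1 − ρ) ≅ ℤ/3`). [cite: Lawden1989, §9.8 eq. (9.8.14)] -/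
theorem one_sub_rho_mul_mem_lattice_iff (x : ℂ) :
    (1 - (UpperHalfPlane.ρ : ℂ)) * x ∈ (ofUpperHalfPlane UpperHalfPlane.ρ).lattice ↔
      x ∈ (ofUpperHalfPlane UpperHalfPlane.ρ).lattice ∨ x - (2 + (UpperHalfPlane.ρ : ℂ)) / 3 ∈ (ofUpperHalfPlane UpperHalfPlane.ρ).lattice ∨
        x + (2 + (UpperHalfPlane.ρ : ℂ)) / 3 ∈ (ofUpperHalfPlane UpperHalfPlane.ρ).lattice := by
  have hw1 := one_sub_rho_mul_two_add_rho_third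
  constructor
  · intro hx
    obtain ⟨m, n, h⟩ := EisensteinLattice.mem_lattice_iff.mp hx
    -- `x = ((1 − ρ)x)·(2 + ρ)/3 = (mρ + n)(2 + ρ)/3 = ((m + n)ρ + (2n − m))/3`
    have hx' : x = ((m : ℂ) * UpperHalfPlane.ρ + n) * ((2 + (UpperHalfPlane.ρ : ℂ)) / 3) := by
      rw [h]; linear_combination (-x) * hw1
    have key : ∀ j q : ℤ, m + n - j = 3 * q →
        x - (j : ℂ) * ((2 + (UpperHalfPlane.ρ : ℂ)) / 3) = ((q : ℤ) : ℂ) * UpperHalfPlane.ρ + ((2 * q - m : ℤ) : ℂ) := by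
      intro j q hjq
      have hjq' : ((m + n - j : ℤ) : ℂ) = ((3 * q : ℤ) : ℂ) := by rw [hjq]
      push_cast at hjq' ⊢
      apply mul_right_cancel₀ (by norm_num : (3 : ℂ) ≠ 0)
      have e3 : (x - (j : ℂ) * ((2 + (UpperHalfPlane.ρ : ℂ)) / 3)) * 3 = ((m : ℂ) * UpperHalfPlane.ρ + n - j) * (2 + UpperHalfPlane.ρ) := by
        rw [hx']; ring
      rw [e3]
      linear_combination ((UpperHalfPlane.ρ : ℂ) + 2) * hjq' + (m : ℂ) * UpperHalfPlane.ρ_sq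
    have hmem : ∀ j q : ℤ, m + n - j = 3 * q →
        x - (j : ℂ) * ((2 + (UpperHalfPlane.ρ : ℂ)) / 3) ∈ (ofUpperHalfPlane UpperHalfPlane.ρ).lattice := by
      intro j q hjq
      rw [key j q hjq, EisensteinLattice.mem_lattice_iff]
      exact ⟨q, 2 * q - m, by push_cast; ring⟩
    -- `m + n ≡ 0, 1, −1 (mod 3)`
    have h3 : ∃ j : ℤ, (j = 0 ∨ j = 1 ∨ j = -1) ∧ ∃ q : ℤ, m + n - j = 3 * q := by
      have h0 := Int.emod_nonneg (m + n) (by norm_num : (3 : ℤ) ≠ 0)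
      have h1 := Int.emod_lt_of_pos (m + n) (by norm_num : (0 : ℤ) < 3)
      interval_cases hr : (m + n) % 3
      · exact ⟨0, Or.inl rfl, (m + n) / 3, by omega⟩
      · exact ⟨1, Or.inr (Or.inl rfl), (m + n) / 3, by omega⟩
      · exact ⟨-1, Or.inr (Or.inr rfl), (m + n) / 3 + 1, by omega⟩
    obtain ⟨j, hj, q, hq⟩ := h3
    rcases hj with rfl | rfl | rfl
    · left; simpa using hmem 0 q hq
    · right; left; simpa using hmem 1 q hq
    · right; right
      have := hmem (-1) q hq
      simpa [sub_neg_eq_add] using this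
  · rintro (h | h | h)
    · exact one_sub_rho_mul_mem h
    · have := one_sub_rho_mul_mem h
      rw [mul_sub, hw1] at this
      simpa using add_mem this (ofUpperHalfPlane UpperHalfPlane.ρ).ω₂_mem_lattice
    · have := one_sub_rho_mul_mem h
      rw [mul_add, hw1] at this
      simpa using sub_mem this (ofUpperHalfPlane UpperHalfPlane.ρ).ω₂_mem_lattice

/-! ### `℘(w) = 0` and the transformation of order three -/

/-- **`℘((2 + ρ)/3) = 0`**: `ρw = w − 1 ≡ w (mod Λ)`, so `ρ℘(w) = ℘(ρw) = ℘(w)` and `ρ ≠ 1`. (The zeros of the equianharmonic `℘` are the two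
`3`-division points `±(2 + ρ)/3` fixed by the automorphism `ρ`; on `y² = x³ − 1` they are the points `(0, ±i)` of order `3`.)
[cite: Cox2013, §10.C] -/
theorem weierstrassP_two_add_rho_third : ℘[ofUpperHalfPlane UpperHalfPlane.ρ] ((2 + (UpperHalfPlane.ρ : ℂ)) / 3) = 0 := by
  set w : ℂ := (2 + (UpperHalfPlane.ρ : ℂ)) / 3 with hw
  have hρw : (UpperHalfPlane.ρ : ℂ) * w = w + (-1 : ℂ) := by
    rw [hw]; linear_combination (1 / 3 : ℂ) * UpperHalfPlane.ρ_sq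
  have h1 : ℘[ofUpperHalfPlane UpperHalfPlane.ρ] ((UpperHalfPlane.ρ : ℂ) * w) = ℘[ofUpperHalfPlane UpperHalfPlane.ρ] w := by
    rw [hρw]
    have hm : (-1 : ℂ) ∈ (ofUpperHalfPlane UpperHalfPlane.ρ).lattice := neg_mem (ofUpperHalfPlane UpperHalfPlane.ρ).ω₂_mem_lattice
    exact (ofUpperHalfPlane UpperHalfPlane.ρ).weierstrassP_add_coe w ⟨-1, hm⟩
  rw [weierstrassP_rho_mul] at h1
  have h2 : ((UpperHalfPlane.ρ : ℂ) - 1) * ℘[ofUpperHalfPlane UpperHalfPlane.ρ] w = 0 := by linear_combination h1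
  rcases mul_eq_zero.mp h2 with h | h
  · exact absurd (sub_eq_zero.mp h) ρ_ne_one
  · exact h

/-- **`℘((1 − ρ)z) = −ρ²(℘(z)³ − g₃)/(3℘(z)²)`** for `(1 − ρ)z ∉ Λ` (then `z, z ± w ∉ Λ` and `℘(z) ≠ 0`): the transformation of order three
`℘_{(1−ρ)⁻¹Λ}(z) = ℘(z) + ℘(z − w) + ℘(z + w) − 2℘(w)` with `℘(w) = 0`, `g₂ = 0`, `℘(z + w) + ℘(z − w) = −g₃/℘(z)²`, and the homogeneity
`℘_{(1−ρ)⁻¹Λ}(z) = (1 − ρ)²℘((1 − ρ)z)`, `(1 − ρ)² = −3ρ`. [cite: Lawden1989, §9.8 eq. (9.8.14)] -/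
theorem weierstrassP_one_sub_rho_mul {z : ℂ} (hz : (1 - (UpperHalfPlane.ρ : ℂ)) * z ∉ (ofUpperHalfPlane UpperHalfPlane.ρ).lattice) :
    ℘[ofUpperHalfPlane UpperHalfPlane.ρ] z ≠ 0 ∧
    ℘[ofUpperHalfPlane UpperHalfPlane.ρ] ((1 - (UpperHalfPlane.ρ : ℂ)) * z) =
      -(UpperHalfPlane.ρ : ℂ) ^ 2 * (℘[ofUpperHalfPlane UpperHalfPlane.ρ] z ^ 3 - (ofUpperHalfPlane UpperHalfPlane.ρ).g₃) /
        (3 * ℘[ofUpperHalfPlane UpperHalfPlane.ρ] z ^ 2) := by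
  set Λ := ofUpperHalfPlane UpperHalfPlane.ρ with hΛdef
  set w : ℂ := (2 + (UpperHalfPlane.ρ : ℂ)) / 3 with hw
  have hα : (1 - (UpperHalfPlane.ρ : ℂ)) ≠ 0 := sub_ne_zero.mpr (Ne.symm ρ_ne_one)
  set L' : PeriodPair := Λ.mulLeft (1 - (UpperHalfPlane.ρ : ℂ))⁻¹ (inv_ne_zero hα) with hL'
  have hΛ' : ∀ x, x ∈ L'.lattice ↔ x ∈ Λ.lattice ∨ x - w ∈ Λ.lattice ∨ x + w ∈ Λ.lattice := fun x ↦ by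
    rw [hL', PeriodPair.mem_mulLeft_inv_lattice hα]; exact one_sub_rho_mul_mem_lattice_iff x
  have hz' : z ∉ L'.lattice := by rwa [hL', PeriodPair.mem_mulLeft_inv_lattice hα]
  have hwΛ : w ∉ Λ.lattice := two_add_rho_third_notMem
  have h2w : 2 * w ∉ Λ.lattice := two_mul_two_add_rho_third_notMem
  have H := PeriodPair.weierstrassP_of_indexThree hΛ' hwΛ h2w hz'
  have hzΛ := PeriodPair.notMem_of_notMem_of_indexThree hΛ' hz'
  have hzw := PeriodPair.sub_notMem_of_notMem_of_indexThree hΛ' hz'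
  have hzw' := PeriodPair.add_notMem_of_notMem_of_indexThree hΛ' hz'
  have S := PeriodPair.weierstrassP_add_add_weierstrassP_sub hzΛ hwΛ hzw hzw'
  rw [show ℘[Λ] w = 0 from weierstrassP_two_add_rho_third, PeriodPair.g₂_ofUpperHalfPlane_ρ] at S
  -- `℘(z) ≠ 0`
  have hP0 : ℘[Λ] z ≠ 0 := by
    intro h0
    have : ℘[Λ] z = ℘[Λ] w := by rw [h0]; exact weierstrassP_two_add_rho_third.symm
    rcases (Λ.weierstrassP_eq_weierstrassP_iff hzΛ hwΛ).mp this with h' | h'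
    · exact hzw' h'
    · exact hzw h'
  refine ⟨hP0, ?_⟩
  -- homogeneity `℘_{α⁻¹Λ}(z) = α²℘(αz)`
  have hhom : ℘[L'] z = (1 - (UpperHalfPlane.ρ : ℂ)) ^ 2 * ℘[Λ] ((1 - (UpperHalfPlane.ρ : ℂ)) * z) := by
    have h := PeriodPair.weierstrassP_mulLeft (1 - (UpperHalfPlane.ρ : ℂ))⁻¹ (inv_ne_zero hα) Λ ((1 - (UpperHalfPlane.ρ : ℂ)) * z)
    rw [← mul_assoc, inv_mul_cancel₀ hα, one_mul] at h
    rw [hL', h, inv_pow, inv_inv]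
  rw [hhom, show ℘[Λ] w = 0 from weierstrassP_two_add_rho_third, add_assoc, add_comm (℘[Λ] (z - w)), S] at H
  -- H : (1 − ρ)² ℘((1−ρ)z) = ℘ z + (…)/(℘ z − 0)² − 2·0
  have hsq : (1 - (UpperHalfPlane.ρ : ℂ)) ^ 2 = -3 * UpperHalfPlane.ρ := by linear_combination UpperHalfPlane.ρ_sq
  have h3 : (UpperHalfPlane.ρ : ℂ) ^ 3 = 1 := ρ_cube
  rw [eq_div_iff (mul_ne_zero three_ne_zero (pow_ne_zero 2 hP0))]
  have H' : (1 - (UpperHalfPlane.ρ : ℂ)) ^ 2 * ℘[Λ] ((1 - (UpperHalfPlane.ρ : ℂ)) * z) * ℘[Λ] z ^ 2 = ℘[Λ] z ^ 3 - Λ.g₃ := by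
    rw [H]
    field_simp
    ring
  rw [hsq] at H'
  linear_combination (-(UpperHalfPlane.ρ : ℂ) ^ 2) * H' + (-(3 : ℂ) * ℘[Λ] ((1 - (UpperHalfPlane.ρ : ℂ)) * z) * ℘[Λ] z ^ 2) * h3

/-- **Normalised form** (coordinate `X = ℘/ϖ₁²` of `y² = x³ − 1`, `g₃(Λ) = 4ϖ₁⁶`): for `(1 − ρ)z ∉ Λ`,
**`X((1 − ρ)z) = −ρ²·(X(z)³ − 4)/(3X(z)²)`** and `X(z) ≠ 0`. [cite: Lawden1989, §9.8 eq. (9.8.14)] -/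
theorem normalizedX_one_sub_rho_mul {z : ℂ} (hz : (1 - (UpperHalfPlane.ρ : ℂ)) * z ∉ (ofUpperHalfPlane UpperHalfPlane.ρ).lattice) :
    ℘[ofUpperHalfPlane UpperHalfPlane.ρ] z / (((2 : ℝ) ^ (2 / 3 : ℝ) * Real.Gamma (1 / 3) ^ 3 / (4 * Real.pi) : ℝ) : ℂ) ^ 2 ≠ 0 ∧
    ℘[ofUpperHalfPlane UpperHalfPlane.ρ] ((1 - (UpperHalfPlane.ρ : ℂ)) * z) / (((2 : ℝ) ^ (2 / 3 : ℝ) * Real.Gamma (1 / 3) ^ 3 / (4 * Real.pi) : ℝ) : ℂ) ^ 2 =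
      -(UpperHalfPlane.ρ : ℂ) ^ 2 *
        ((℘[ofUpperHalfPlane UpperHalfPlane.ρ] z / (((2 : ℝ) ^ (2 / 3 : ℝ) * Real.Gamma (1 / 3) ^ 3 / (4 * Real.pi) : ℝ) : ℂ) ^ 2) ^ 3 - 4) /
        (3 * (℘[ofUpperHalfPlane UpperHalfPlane.ρ] z / (((2 : ℝ) ^ (2 / 3 : ℝ) * Real.Gamma (1 / 3) ^ 3 / (4 * Real.pi) : ℝ) : ℂ) ^ 2) ^ 2) := by
  obtain ⟨hP0, hP⟩ := weierstrassP_one_sub_rho_mul hz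
  set ϖ : ℂ := (((2 : ℝ) ^ (2 / 3 : ℝ) * Real.Gamma (1 / 3) ^ 3 / (4 * Real.pi) : ℝ) : ℂ) with hϖ
  have hϖ0 : ϖ ≠ 0 := Complex.ofReal_ne_zero.mpr varpi₁_pos.ne'
  have hg3 : (ofUpperHalfPlane UpperHalfPlane.ρ).g₃ = 4 * ϖ ^ 6 := by rw [hϖ, g₃_eq_four_mul_varpi₁_pow_six]
  refine ⟨div_ne_zero hP0 (pow_ne_zero 2 hϖ0), ?_⟩
  rw [hP, hg3]
  field_simp

/-- **The `π`-form of `[1 − ρ]`**: with `π = X⁻¹`, for `(1 − ρ)z ∉ Λ` and `X((1 − ρ)z) ≠ 0`: `X(z)³ ≠ 4` and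
`π((1 − ρ)z) = −3ρ·X(z)²/(X(z)³ − 4)` (`= −3ρ·π(z)/(1 − 4π(z)³)`). [cite: Lawden1989, §9.8 eq. (9.8.14)] -/
theorem inv_normalizedX_one_sub_rho_mul {z : ℂ} (hz : (1 - (UpperHalfPlane.ρ : ℂ)) * z ∉ (ofUpperHalfPlane UpperHalfPlane.ρ).lattice)
    (hX0 : ℘[ofUpperHalfPlane UpperHalfPlane.ρ] ((1 - (UpperHalfPlane.ρ : ℂ)) * z) /
      (((2 : ℝ) ^ (2 / 3 : ℝ) * Real.Gamma (1 / 3) ^ 3 / (4 * Real.pi) : ℝ) : ℂ) ^ 2 ≠ 0) :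
    (℘[ofUpperHalfPlane UpperHalfPlane.ρ] z / (((2 : ℝ) ^ (2 / 3 : ℝ) * Real.Gamma (1 / 3) ^ 3 / (4 * Real.pi) : ℝ) : ℂ) ^ 2) ^ 3 - 4 ≠ 0 ∧
    (℘[ofUpperHalfPlane UpperHalfPlane.ρ] ((1 - (UpperHalfPlane.ρ : ℂ)) * z) /
        (((2 : ℝ) ^ (2 / 3 : ℝ) * Real.Gamma (1 / 3) ^ 3 / (4 * Real.pi) : ℝ) : ℂ) ^ 2)⁻¹ =
      -3 * (UpperHalfPlane.ρ : ℂ) * (℘[ofUpperHalfPlane UpperHalfPlane.ρ] z / (((2 : ℝ) ^ (2 / 3 : ℝ) * Real.Gamma (1 / 3) ^ 3 / (4 * Real.pi) : ℝ) : ℂ) ^ 2) ^ 2 /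
        ((℘[ofUpperHalfPlane UpperHalfPlane.ρ] z / (((2 : ℝ) ^ (2 / 3 : ℝ) * Real.Gamma (1 / 3) ^ 3 / (4 * Real.pi) : ℝ) : ℂ) ^ 2) ^ 3 - 4) := by
  obtain ⟨hX, hX'⟩ := normalizedX_one_sub_rho_mul hz
  set X : ℂ := ℘[ofUpperHalfPlane UpperHalfPlane.ρ] z / (((2 : ℝ) ^ (2 / 3 : ℝ) * Real.Gamma (1 / 3) ^ 3 / (4 * Real.pi) : ℝ) : ℂ) ^ 2 with hXdef
  set X' : ℂ := ℘[ofUpperHalfPlane UpperHalfPlane.ρ] ((1 - (UpperHalfPlane.ρ : ℂ)) * z) /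
      (((2 : ℝ) ^ (2 / 3 : ℝ) * Real.Gamma (1 / 3) ^ 3 / (4 * Real.pi) : ℝ) : ℂ) ^ 2 with hX'def
  have h3 : (UpperHalfPlane.ρ : ℂ) ^ 3 = 1 := ρ_cube
  have hρ0 : (UpperHalfPlane.ρ : ℂ) ≠ 0 := ρ_ne_zero
  -- `X³ ≠ 4` since `X' ≠ 0`
  have hX34 : X ^ 3 - 4 ≠ 0 := by
    intro h
    apply hX0
    rw [hX', h]; ring
  refine ⟨hX34, ?_⟩
  have hnum : -(UpperHalfPlane.ρ : ℂ) ^ 2 * (X ^ 3 - 4) ≠ 0 :=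
    mul_ne_zero (neg_ne_zero.mpr (pow_ne_zero 2 hρ0)) hX34
  rw [hX', inv_div, div_eq_div_iff hnum hX34]
  linear_combination (-(3 : ℂ) * X ^ 2 * (X ^ 3 - 4)) * h3

end EisensteinLattice

end Literature.NumberTheory.EllipticCurves

end
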